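import Summits.HodgeConjecture.HodgeCM.PerL34.GenuineSchrodingerCoeff_2

/-! PORT of `HodgeCM/PerL34/GenuineSchrodingerCoeff.lean` (HodgeCMPerL run 82) — part 3: continuation of `Summits.HodgeConjecture.HodgeCM.PerL34.GenuineSchrodingerCoeff_2` (split at a top-level declaration boundary by port_pkg.py; scope re-opened below; declarations unchanged). -/

-- port_pkg: scope re-opened for this part (file-level context, then the namespace/section stack open at the cut)
set_option linter.style.longFile 0
set_option linter.unusedSectionVars false
set_option linter.unusedVariables false
noncomputable section
open MeasureTheory MeasureTheory.Measure Set Metric Function Complex ComplexConjugate Topology Filter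
open scoped RestrictedProduct InnerProductSpace NNReal ENNReal Pointwise
namespace HodgeCM.PerL34.PureTensor
open HodgeCM.PerL34.LocalFactors HodgeCM.PerL34.LocalFactors.DilationModel
open HodgeCM.PerL34.IdelePlaces HodgeCM.PerL34.RestrictedRegroup HodgeCM.PerL34.RestrictedCutout
open HodgeCM.PerL34.IdelicTorusModel HodgeCM.PerL34.IdelicTorusModel.Genuine NumberField IsDedekindDomain
open HodgeCM.PerL34.NoSmallSubgroups
attribute [local instance] LocalFactors.DilationModel.Adic.nontriviallyNormedField
  LocalFactors.DilationModel.Adic.properSpace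
namespace SchrodingerModel
variable {L : Type} [Field L] [NumberField L] [IsCMField L]
local notation3 "L⁺" => maximalRealSubfield L
local notation3 "𝕂" i => (basePlaceOf L (Subtype.val i)).adicCompletion (maximalRealSubfield L)
namespace Coeff
section Main
variable [∀ v : HeightOneSpectrum (𝓞 (maximalRealSubfield L)), MeasurableSpace (v.adicCompletion (maximalRealSubfield L))]
  [∀ v : HeightOneSpectrum (𝓞 (maximalRealSubfield L)), BorelSpace (v.adicCompletion (maximalRealSubfield L))]
  [DecidableEq (Place (maximalRealSubfield L))]
/-- the untwisted case (`ν = 1`, pv13-g4's `thetaInputOfNonsplit`): all binders, for `χ` trivial on the `S`-components -/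
theorem torusSide_one (S : Finset (Place L⁺)) (hSns : ∀ i ∈ S, ¬IsSplitPlace L i) (χ : Model L →* Circle)
    (hχ : ∀ i ∈ S, ∀ g : locTorus L⁺ L i, χ (RestrictedProduct.mulSingle (genLevel L) i g) = 1) (T : Finset (Place L⁺)) :
    Nonempty (GenuineThetaInput L S (Lp ℂ 2 (μ L)) (rep L 1) (phi0 L) χ) ∧
    ‖phi0 L‖ = 1 ∧
    (∀ (i : Place L⁺) (v : Lp ℂ 2 (μ L)),
      Continuous fun g : locTorus L⁺ L i => rep L 1 (RestrictedProduct.mulSingle (genLevel L) i g) v) ∧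
    (∀ k ∈ RestrictedProduct.boxSubgroup (genLevel L) T, rep L 1 k (phi0 L) = phi0 L) ∧
    (∀ S' : Finset (Place L⁺), T ⊆ S' → ∀ y : (i : ↥S') → locTorus L⁺ L i,
      inner ℂ (phi0 L) (rep L 1 (extendOne (genLevel L) S' y) (phi0 L)) =
        ∏ i : ↥S', localCoeff (genLevel L) (rep L 1) (phi0 L) i (y i)) :=
  ⟨nonempty_thetaInput_of_nonsplit S hSns χ hχ, norm_phi0, hloc_one, rep_phi0_eq_self_of_mem_boxSubgroup T, hM_phi0 1 T⟩

end Main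

end Coeff

end SchrodingerModel

end HodgeCM.PerL34.PureTensor

end
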